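import Mathlib
import HarnessLib
import HarnessLib.Audit
import Summits.Langlands.Statement
import Summits.Langlands.Langlands.Theses.TwistControlLadder
import Summits.Langlands.Langlands.Theses.QuarterConductorLadder
import Literature.NumberTheory.Automorphic.StrongApproximationGL2
import Literature.NumberTheory.Automorphic.GLnAdelicStructureProofs

/-!
# BC3 birth skeleton — crux `QuarterCensusBand` (QB) of the lens-1-g18 child route `QuarterConductorLadder`
# (cutting WHS = `Summit.Langlands.Langlands.Theses.TwistControlLadder.WeaklyRegularHullAvatars` stmt-Langlands-33573 by the twist-minimal conductor of the even λ = 1/4 seed)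

Line «census → dictionary → transport» (memo §3–5, line card `birth_QB.md`).  POST-BIRTH form (.post): the crux is the TREE decl of route-Langlands-QuarterConductorLadder BY NAME (it was a LOCAL verbatim copy of the
route.json text before birth (namespace `…Cruxes.QuarterCensusBand.Birth`); after birth the writer/lead swaps the local `def QuarterCensusBand` for the tree decl `Summit.Langlands.Langlands.Theses.QuarterConductorLadder.QuarterCensusBand`
(same text ⇒ the composition still elaborates) and registers the file as `Lines/birth.lean`.

Stubs (genuine lemmas of the line; sorries ONLY here):
  stub₁ `stub_quarterCensus1950` : QUARTER CENSUS up to N ≤ 1950 (the band's own content is 881 ≤ N ≤ 1950; the stub is stated cumulatively — the ≤ 880 part is QF's stub verbatim) — every cuspidal π₀ on GL₂/ℚ with archimedean parameter {0,0}, EVEN sign at ∞ and a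
         K₁(N)-newvector (N in range) has semisimple ℓ-adic avatars over ℚ.  Content: adelic→classical newform dictionary (tree `CorrespondentFingerprint.stub_descent`
         pattern, LANDED for the 1951 cell) + the Booker–Lee–Strömbergsson certificates (min Q_(χ,ε) < 1 ⇒ N_ε(1/4) = n_(χ,ε): the form is dihedral / tetrahedral /
         octahedral) + Hecke–Maass & Langlands–Tunnell (tree `LanglandsTunnell*.lean`) ⇒ an Artin representation with matching Frobenius traces ⇒ its ℓ-adic
         realisation (finite image ⇒ semisimple).  L-sized; PRINT ∪ INSTRUMENT (non-admissible characters 881…1950: census-1).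
         CITES (crit-1 row 227 y1/y2): the print content is ONLY the «min Q_(χ,ε) < 1» rows of [corpus:paper:arxiv-1803.06016] §5 p29 L44–L55 (h ≥ 1 on i[0,½];
         «whenever the resulting minimal value of Q_(χ,ε) is less than 1, we deduce both the Selberg conjecture and the completeness of the list of nondihedral Artin
         representations for twist-minimal forms of character χ»), Thm 1 p3 L11–L13 (every twist-minimal space of conductor ≤ 880), and for 881…1950 the admissible-character runs behind Thm 2 (p3 L15–L18) with the exception list p28 L103–L111 = {2221, 2341, 2381, 2529, 2799} (all > 1950) — NOT Thm 2's Artin-conditional completeness claim itself: below 1951 n_(χ,ε) has no icosahedral term (Rem. 3 p3 L84–L91), so the Q < 1 rows are unconditional there.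
         The census enters the tree as ONE computational cited fact with per-(N, χ, ε) rows (tree format `MaassHeckeTraceCensus`, Literature/NumberTheory/Automorphic/CertifiedMaassHeckeTraceCensus.lean) so that census-1 can re-verify samples.
  stub₂ `stub_boxTransport` : BOX TRANSPORT — avatars pass along the a.e. relation P_w ↔ (α_u^f, χ_w): ρ := ρ₀|_(Γ_K) ⊗ (ℓ-adic character of the
         L-algebraic GL₁ datum χ, tree `AlgebraicHeckeCharacterData`/CFT pattern); Frobenius at w ↦ Frob_u^f gives the charpoly of α^f; semisimplicity is
         preserved by restriction to the open subgroup Γ_K and by twisting.  M-sized; PRINT (class field theory + linear algebra).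
Composition `quarterCensusBand_of` destructures the box hypothesis (`subst n = 2`) and chains stub₁ → stub₂; it concludes the crux BY NAME.  Probes S0–S5: no stub alone
gives the crux or Langlands on the cheap, no stub is cheap outright.  rc 0 with sorries = 2 (stub_* only) is the certificate.
-/

set_option linter.dupNamespace false
set_option linter.unreachableTactic false
set_option linter.unusedTactic false
set_option linter.unusedVariables false
set_option maxHeartbeats 400000

namespace Summit.Langlands.Langlands.Cruxes.QuarterCensusBand.Birth

open scoped BigOperators Topology Manifold Classical MeasureTheory ProbabilityTheory Matrix InnerProductSpace ComplexConjugate ContinuousMap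
open Filter Set Function TopologicalSpace MeasureTheory
open Literature.NumberTheory.Automorphic Literature.NumberTheory.GaloisRepresentations

/-- AFTER BIRTH (route-Langlands-QuarterConductorLadder rev 0 @6d9c899ddd97, QB = the tree item): the crux is the TREE decl, referenced BY NAME. -/
abbrev QuarterCensusBand : Prop :=
  Summit.Langlands.Langlands.Theses.QuarterConductorLadder.QuarterCensusBand

/-- stub₁ text · QUARTER CENSUS up to N ≤ 1950. -/
def QuarterCensus1950 : Prop :=
  ∀ (ℓ : ℕ) [Fact ℓ.Prime] (ι : PadicAlgCl ℓ ≃+* ℂ) (h₀ : Literature.NumberTheory.Automorphic.isCompact_glFiniteIntegralLevel 2 ℚ) (π₀ : Literature.NumberTheory.Automorphic.CuspidalAutomorphicRepData 2 ℚ h₀), π₀.1.HasArchParameter (fun _ => ({0, 0} : Multiset ℂ)) → (∀ φ ∈ π₀.1.W, Literature.NumberTheory.Automorphic.rightTranslation (Literature.NumberTheory.Automorphic.AdelicGroupData.gl 2 ℚ) ((Literature.NumberTheory.Automorphic.AutomorphyDatum.gl 2 ℚ h₀).ofArch ⟨-1, trivial⟩) φ - φ ∈ π₀.1.W') → (∃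 N : ℕ, 0 < N ∧ N ≤ 1950 ∧ ∃ φ ∈ π₀.1.W, φ ∉ π₀.1.W' ∧ ∀ u ∈ Literature.NumberTheory.Automorphic.gammaOneFiniteLevel ℚ (Ideal.span {(N : NumberField.RingOfIntegers ℚ)}), Literature.NumberTheory.Automorphic.rightTranslation (Literature.NumberTheory.Automorphic.AdelicGroupData.gl 2 ℚ) (show (Literature.NumberTheory.Automorphic.AdelicGroupData.gl 2 ℚ).Adelic from Literature.NumberTheory.Automorphic.GLn.ofFinite 2 ℚ u) φ - φ ∈ π₀.1.W') → ∃ ρ₀ : Literature.NumberTheory.GaloisRepresentations.FramedGaloisRep ℚ (PadicAlgCl ℓ) 2, ρ₀.toGaloisRep.IsSemisimple ∧ ∀ᶠ v : IsDedekindDomain.HeightOneSpectrum (NumberField.RingOfIntegers ℚ) in Filter.cofinite, SatakeFrobCompatibleAt ι π₀.1 ρ₀ v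

/-- stub₂ text · BOX TRANSPORT along the a.e.-twisted base-change relation. -/
def BoxTransport : Prop :=
  ∀ (K : Type) [Field K] [NumberField K] (hcpt : Literature.NumberTheory.Automorphic.isCompact_glFiniteIntegralLevel 2 K) (P : Literature.NumberTheory.Automorphic.AutomorphicRepData (Literature.NumberTheory.Automorphic.AutomorphyDatum.gl 2 K hcpt)) (ℓ : ℕ) [Fact ℓ.Prime] (ι : PadicAlgCl ℓ ≃+* ℂ) (h₀ : Literature.NumberTheory.Automorphic.isCompact_glFiniteIntegralLevel 2 ℚ) (π₀ : Literature.NumberTheory.Automorphic.CuspidalAutomorphicRepData 2 ℚ h₀) (h₁ : Literature.NumberTheory.Automorphic.isCompact_glFiniteIntegralLevel 1 K) (χ : Literature.NumberTheory.Automorphic.AutomorphicRepData (Literature.NumberTheory.Automorphic.AutomorphyDatum.gl 1 K h₁)) (ρ₀ : Literature.NumberTheory.GaloisRepresentations.FramedGaloisRep ℚ (PadicAlgCl ℓ) 2), ρ₀.toGaloisRep.IsSemisimple → (∀ᶠ u : IsDedekindDomain.HeightOneSpectrum (NumberField.RingOfIntegers ℚ) in Filter.cofinite, SatakeFrobCompatibleAt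 ι π₀.1 ρ₀ u) → χ.IsLAlgebraic → (∀ᶠ w : IsDedekindDomain.HeightOneSpectrum (NumberField.RingOfIntegers K) in Filter.cofinite, ∀ (u : IsDedekindDomain.HeightOneSpectrum (NumberField.RingOfIntegers ℚ)) (α : Multiset ℂ) (c : ℂ), w.asIdeal.under (NumberField.RingOfIntegers ℚ) = u.asIdeal → π₀.1.HasSatakeParamAt u α → χ.HasSatakeParamAt w {c} → P.HasSatakeParamAt w ((α.map (· ^ w.asIdeal.inertiaDeg (NumberField.RingOfIntegers ℚ))).map (c * ·))) → ∃ ρ : Literature.NumberTheory.GaloisRepresentations.FramedGaloisRep K (PadicAlgCl ℓ) 2, ρ.toGaloisRep.IsSemisimple ∧ ∀ᶠ v : IsDedekindDomain.HeightOneSpectrum (NumberField.RingOfIntegers K) in Filter.cofinite, SatakeFrobCompatibleAt ι P ρ v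

/-- stub₁ — the census + dictionary (PRINT: BLS20 Thm 1/2 + §5, Hecke–Maass, Langlands–Tunnell). -/
theorem stub_quarterCensus1950 : QuarterCensus1950 := by
  sorry

/-- stub₂ — restriction to Γ_K ⊗ χ_ℓ (PRINT: CFT). -/
theorem stub_boxTransport : BoxTransport := by
  sorry

/-- COMPOSITION — concludes the crux `QuarterCensusBand` BY NAME from the two stubs (real proof, no sorry). -/
theorem quarterCensusBand_of (hA : QuarterCensus1950) (hTr : BoxTransport) : QuarterCensusBand := by
  intro K _ _ n hcpt hn π hL hbox hnot h2 h3 ℓ _ ι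
  obtain ⟨hn2, h₀, π₀, h₁, χ, hM, hE, hcond, hχ, hrel⟩ := hbox
  subst hn2
  obtain ⟨ρ₀, hss, hc⟩ := hA ℓ ι h₀ π₀ hM hE hcond
  exact hTr K hcpt π.1 ℓ ι h₀ π₀ h₁ χ ρ₀ hss hc hχ hrel

theorem quarterCensusBand_holds_of_stubs : QuarterCensusBand :=
  quarterCensusBand_of stub_quarterCensus1950 stub_boxTransport

/-- `ledger skeleton check` handle: the FQ tree crux BY NAME from the two stubs (operator INBOX 2026-08-30T22:51Z: «no by-name concluding theorem» ⇒ this). -/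
theorem QuarterCensusBand_proof : Summit.Langlands.Langlands.Theses.QuarterConductorLadder.QuarterCensusBand :=
  quarterCensusBand_of stub_quarterCensus1950 stub_boxTransport

/-- NON-VACUITY of the dial's seed binder (crit-1 row 227 y3): `h₀` is dischargeable, so the box is not empty for lack of a level structure on GL₂/ℚ.
(An in-box π itself = an even tetrahedral/octahedral Maass newform of conductor in range, e.g. the first rows of BLS Table 1; exhibiting one in Lean needs a constructed
Maass form and is left to the prover/census — it is the refuter's check (iii), not a stub.) -/
example : Literature.NumberTheory.Automorphic.isCompact_glFiniteIntegralLevel 2 ℚ :=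
  Literature.NumberTheory.Automorphic.isCompact_glFiniteIntegralLevel_holds 2 ℚ

/-! ## Per-stub probes (fail_if_success: rc 0 ⇒ every cheap attempt FAILED) -/

-- S0: stub₁ alone ↛ crux
example : True := by
  fail_if_success
    have : QuarterCensus1950 → QuarterCensusBand := by
      first | exact fun h => h | (intros; assumption) | (intros; trivial) | tauto
  trivial

-- S1: stub₂ alone ↛ crux
example : True := by
  fail_if_success
    have : BoxTransport → QuarterCensusBand := by
      first | exact fun h => h | (intros; assumption) | (intros; trivial) | tauto
  trivial

-- S2: stub₁ ↛ Langlands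
example : True := by
  fail_if_success
    have : QuarterCensus1950 → _root_.Langlands := by
      first | exact fun h => h | (intros; assumption) | (intros; trivial) | tauto
  trivial

-- S3: stub₂ ↛ Langlands
example : True := by
  fail_if_success
    have : BoxTransport → _root_.Langlands := by
      first | exact fun h => h | (intros; assumption) | (intros; trivial) | tauto
  trivial

-- S4: stub₁ not cheap outright
example : True := by
  fail_if_success
    have : QuarterCensus1950 := by
      first | exact fun h => h | (intros; assumption) | (intros; trivial) | tauto
  trivial

-- S5: stub₂ not cheap outright
example : True := by
  fail_if_success
    have : BoxTransport := by
      first | exact fun h => h | (intros; assumption) | (intros; trivial) | tauto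
  trivial

-- S6: crux ↛ stub₁ cheaply (the census is not the crux reworded: it has no K, no hull hypotheses)
example : True := by
  fail_if_success
    have : QuarterCensusBand → QuarterCensus1950 := by
      first | exact fun h => h | (intros; assumption) | (intros; trivial) | tauto
  trivial

end Summit.Langlands.Langlands.Cruxes.QuarterCensusBand.Birth
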